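import Summits.ValiantsHypothesis.ValiantsHypothesis.Theorems.NcOrderedTransfer
import HarnessLib

/-!
# The commutativity dial read as a split of the crux `PerNotSmVP` (no declared residual)

Decomposition workshop `decomp-valiant`, lens 6 «restricted-models lifting axis», gen 4, reading B of
the node `CommutativityDial` (`Theorems.CommutativityDial`, `Theorems.NcOrderedTransfer`). With
Hrubeš–Wigderson–Yehudayoff's simulation in the kernel (`NcOrderedTransfer.perNotNcVP_of_perNotSmVP :
PerNotSmVP → PerNotNcVP`), the gen-2 CRUX `DecompCycle1.PerNotSmVP` (stmt-ValiantsHypothesis-23661)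
splits EXACTLY as

  `PerNotSmVP ⟺ PerNotNcVP ∧ SmToNcPer`,  `SmToNcPer := (PerNotNcVP → PerNotSmVP)`

(`perNotSmVP_iff_ncSplit`), where BOTH pieces are implied by the summit (`perNotNcVP_of_vh`,
`smToNcPer_of_vh`) and neither is known to imply it: `PerNotNcVP` = superpolynomial hardness of the
ordered permanent for NONCOMMUTATIVE circuits (open; HWY10 Thm 1.7 reduces an exponential form of it to
a super-linear sum-of-squares bilinear-complexity bound), `SmToNcPer` = the per-specific CONVERSE
simulation "polynomial syntactically multilinear circuits for `per` ⟹ polynomial noncommutative circuits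
for the ordered permanent" ("such a reduction is not known in the commutative case", HWY10 after
Thm 1.11). The glue for `route edit --split PerNotSmVP --into PerNotNcVP SmToNcPer` is
`perNotSmVP_of_ncSplit` (modus ponens). HONEST FRAMING: bookkeeping over the landed kernel edge; nothing
here bears on `VP ≠ VNP`.

## References
* [HrubesWigdersonYehudayoff2010] P. Hrubeš, A. Wigderson, A. Yehudayoff, Relationless completeness and
  separations, CCC 2010 / ECCC TR10-021, Thm 1.7, Thm 1.11, Thm F.1.
-/

namespace Summit.ValiantsHypothesis.ValiantsHypothesis.Theorems.CommutativityDialSplit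

open Literature.Computability.AlgebraicComplexity
open Summit.ValiantsHypothesis.ValiantsHypothesis.Theorems.CommutativityDial (PerNotNcVP NcLift
  perNotNcVP_of_vh)
open Summit.ValiantsHypothesis.ValiantsHypothesis.Theorems.NcOrderedTransfer (perNotNcVP_of_perNotSmVP)
open Summit.ValiantsHypothesis.ValiantsHypothesis.Theses.DecompCycle1 (PerNotSmVP)

/-- PIECE (UNDECIDED, implied by the summit, not known to imply it): the per-specific converse of the
Hrubeš–Wigderson–Yehudayoff simulation — noncommutative hardness of the ordered permanent transfers
to syntactically multilinear hardness of the permanent; contrapositively, polynomial-size syntactically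
multilinear circuits for `per_n` (for all `n`) would give polynomial-size noncommutative circuits for
the ordered permanents. TEST: a multilinear p-family with polynomial syntactically multilinear circuits
whose ordered version needs superpolynomial noncommutative circuits would refute the GENERAL form (none
known); the per-specific form is open. [cite: HrubesWigdersonYehudayoff2010, Thm 1.11] -/
@[conjecture] def SmToNcPer : Prop := PerNotNcVP → PerNotSmVP

/-- The summit implies the converse-transfer piece (through `PerNotSmVP`).
[cite: HrubesWigdersonYehudayoff2010, Thm 1.11] -/
theorem smToNcPer_of_perNotSmVP (h : PerNotSmVP) : SmToNcPer := fun _ => h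

/-- **The gen-2 crux is NECESSARY** (kernel): `VP ≠ VNP ⟹ PerNotSmVP` — superpolynomial hardness of
`per` for all fan-in-two circuits (`perNotPComputableComplex_iff_holds`) restricts to the syntactically
multilinear ones. [cite: Burgisser2000, Rem. 2.2] -/
theorem perNotSmVP_of_vh (hS : _root_.ValiantsHypothesis) : PerNotSmVP := by
  intro c
  have hS' := perNotPComputableComplex_iff_holds.mpr hS
  by_contra h
  simp only [not_exists, not_forall, not_lt] at h
  apply hS'
  refine ⟨c, fun n => ?_⟩
  obtain ⟨P, hfan, -, hcomp, hsize⟩ := h n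
  exact (ArithCircuit.complexity_le_size hfan hcomp).trans hsize

/-- The summit implies the converse-transfer piece. [cite: HrubesWigdersonYehudayoff2010, Thm 1.11] -/
theorem smToNcPer_of_vh (hS : _root_.ValiantsHypothesis) : SmToNcPer :=
  smToNcPer_of_perNotSmVP (perNotSmVP_of_vh hS)

/-- GLUE of the split `PerNotSmVP ⟸ PerNotNcVP ∧ SmToNcPer` (modus ponens).
[cite: HrubesWigdersonYehudayoff2010, Thm 1.11] -/
theorem perNotSmVP_of_ncSplit (hA : PerNotNcVP) (hT : SmToNcPer) : PerNotSmVP := hT hA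

/-- **The split is EXACT**: `PerNotSmVP ⟺ PerNotNcVP ∧ SmToNcPer` — the forward direction is the
kernel HWY simulation `perNotNcVP_of_perNotSmVP`. [cite: HrubesWigdersonYehudayoff2010, Thm F.1] -/
theorem perNotSmVP_iff_ncSplit : PerNotSmVP ↔ PerNotNcVP ∧ SmToNcPer :=
  ⟨fun h => ⟨perNotNcVP_of_perNotSmVP h, smToNcPer_of_perNotSmVP h⟩, fun h => perNotSmVP_of_ncSplit h.1 h.2⟩

/-- The two readings agree on the residual bookkeeping: the top-level nc residual `NcLift` is exactly
"`PerNotNcVP` decides the summit", and under the converse transfer it reduces to the gen-2 statement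
"`PerNotSmVP` decides the summit". [cite: HrubesWigdersonYehudayoff2010, Thm 1.11] -/
theorem ncLift_of_smToNcPer (hT : SmToNcPer) (hres : PerNotSmVP → _root_.ValiantsHypothesis) : NcLift :=
  CommutativityDial.ncLift_iff_residual.mpr fun hA => hres (hT hA)

end Summit.ValiantsHypothesis.ValiantsHypothesis.Theorems.CommutativityDialSplit
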